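import Mathlib
import Summits.Ventures.PercRepro2.SwOutJunctionsGTypedPull

/-!
# The multi-junction theorem on the general doubly typed side, II: the theorem
(blind cell PercRepro2, night-4 g31, 2026-08-28; proofs/NIGHT4-G31.md §6c)

g30's asymmetric proof with `card_orbit_le_g` and the transports of part I:
**`rigidOK_g_of_junctions`** (every class of a region with an independent set `J` of junctions,
the conditions on `h`'s clusters blind to `J`), **`gTypedSwAll_of_junctions`** (g11's class B2
for g7's row — the transliteration g30 left open).
-/

namespace Summit.Ventures.PercRepro2

namespace LocRows

open Hull

variable {V : Type*} {E : Type*} [Fintype E] [DecidableEq E]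

open scoped Classical

variable {ends : E → Sym2 V} {U : Set V} {ξ : Config E} {l h : V} {J : Set V}
  {𝓤 𝓓 𝓓'' : Set (Set V)} {X : Set V} {𝓤' : Set (Set V)}

section Core

variable {F : V → Prop}

/-- Every core of a `gTypedQ`-configuration is `h` or a junction. -/
theorem core_mem_J_of_out_g (hF : ∀ x, F x → (∀ S ∈ 𝓤, x ∈ S) ∨ (∀ S ∈ 𝓓'', x ∉ S) ∨ x ∈ X)
    (hout : ∀ x ∈ U, x ≠ h → x ∉ J →
      F x ∨ (∃ e y, ends e = s(x, y) ∧ y ∉ U) ∨ (∀ e, x ∉ ends e))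
    {ζ : Config E} (hζ : ζ ∈ gOutSide ends l h 𝓤 𝓓 𝓓'' X 𝓤' U ξ) {x : V}
    (hxT : x ∈ cluster ends ζ h) (hxTp : x ∈ cluster ends (blue ζ) h) : x = h ∨ x ∈ J := by
  by_cases hxh : x = h
  · exact Or.inl hxh
  by_cases hxJ : x ∈ J
  · exact Or.inr hxJ
  exfalso
  have hQ := (mem_gOutSide.1 hζ).1
  have hcl := (mem_gOutSide.1 hζ).2
  rw [mem_gTypedQ] at hQ
  obtain ⟨hhl, hA, -, hRh, hX, -⟩ := hQ
  have hhA : h ∉ cluster ends ζ l := fun h' => hhl (Or.inl h')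
  have hxU : x ∈ U := (mem_outClass.1 hcl).2 (Or.inl hxT)
  rcases hout x hxU hxh hxJ with hf | ⟨e, y, hxy, hyU⟩ | hiso
  · rcases hF x hf with hf' | hf'' | hxX
    · exact hhA (conn_trans (hf' _ hA) (conn_symm hxT))
    · exact hf'' _ hRh hxT
    · exact hX x hxX (Or.inl hxT)
  · cases he : ζ e with
    | true => exact hyU ((mem_outClass.1 hcl).2 (Or.inl (mem_cluster_of_edge hxT he hxy)))
    | false =>
      have he' : blue ζ e = true := by rw [blue_eq_true_iff]; exact he
      exact hyU ((mem_outClass.1 hcl).2 (Or.inr (mem_cluster_of_edge hxTp he' hxy)))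
  · obtain ⟨e, hxe⟩ := exists_edge_of_mem_cluster hxT hxh
    exact hiso e hxe

/-- Every core of a `gTypedQ`-configuration is `h` or a MATCHED junction. -/
theorem core_mem_matchedSet_g (hF : ∀ x, F x → (∀ S ∈ 𝓤, x ∈ S) ∨ (∀ S ∈ 𝓓'', x ∉ S) ∨ x ∈ X)
    (hout : ∀ x ∈ U, x ≠ h → x ∉ J →
      F x ∨ (∃ e y, ends e = s(x, y) ∧ y ∉ U) ∨ (∀ e, x ∉ ends e))
    {ζ : Config E} (hζ : ζ ∈ gOutSide ends l h 𝓤 𝓓 𝓓'' X 𝓤' U ξ) {x : V}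
    (hxT : x ∈ cluster ends ζ h) (hxTp : x ∈ cluster ends (blue ζ) h) :
    x = h ∨ x ∈ matchedSet ends J h ζ := by
  rcases core_mem_J_of_out_g hF hout hζ hxT hxTp with h1 | h1
  · exact Or.inl h1
  · exact Or.inr ⟨h1, matched_of_core hxT hxTp⟩

/-- A `gTypedQ`-configuration is fine for its matched set. -/
theorem mfine_matchedSet_g (hF : ∀ x, F x → (∀ S ∈ 𝓤, x ∈ S) ∨ (∀ S ∈ 𝓓'', x ∉ S) ∨ x ∈ X) (hhJ : h ∉ J) (hind : IndepSet ends J)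
    (hadj : ∀ u ∈ J, ∀ e (he : u ∈ ends e), Sym2.Mem.other he ≠ h →
      ∃ e', ends e' = s(Sym2.Mem.other he, h))
    (hout : ∀ x ∈ U, x ≠ h → x ∉ J →
      F x ∨ (∃ e y, ends e = s(x, y) ∧ y ∉ U) ∨ (∀ e, x ∉ ends e))
    {ζ : Config E} (hζ : ζ ∈ gOutSide ends l h 𝓤 𝓓 𝓓'' X 𝓤' U ξ) :
    MFine ends (matchedSet ends J h ζ) h ζ :=
  mfine_of_matched (indepSet_mono (matchedSet_subset (ends := ends) (h := h) ζ) hind)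
    (fun h' => hhJ h'.1) (fun u hu => hadj u hu.1)
    (fun _ hx hx' => core_mem_matchedSet_g hF hout hζ hx hx') (fun _ hu => hu.2)

/-- A `gTypedQ`-configuration is core-free in the graph split at its matched set. -/
theorem coreFree_split_matchedSet_g (hF : ∀ x, F x → (∀ S ∈ 𝓤, x ∈ S) ∨ (∀ S ∈ 𝓓'', x ∉ S) ∨ x ∈ X) (hhJ : h ∉ J)
    (hind : IndepSet ends J)
    (hout : ∀ x ∈ U, x ≠ h → x ∉ J →
      F x ∨ (∃ e y, ends e = s(x, y) ∧ y ∉ U) ∨ (∀ e, x ∉ ends e))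
    {ζ : Config E} (hζ : ζ ∈ gOutSide ends l h 𝓤 𝓓 𝓓'' X 𝓤' U ξ) :
    CoreFree (splitEndsS ends (matchedSet ends J h ζ)) ζ (Sum.inl h) := by
  have hind' : IndepSet ends (matchedSet ends J h ζ) :=
    indepSet_mono (matchedSet_subset (ends := ends) (h := h) ζ) hind
  rintro (x | e) hxT hxTp
  · have h1 : x ∈ cluster ends ζ h := conn_of_conn_splitS_inl hind' hxT
    have h2 : x ∈ cluster ends (blue ζ) h := conn_of_conn_splitS_inl hind' hxTp
    rcases core_mem_matchedSet_g hF hout hζ h1 h2 with rfl | hxM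
    · rfl
    · exact absurd hxT (inl_S_notMem_cluster_splitS hxM (fun h' => hhJ (h' ▸ hxM.1)))
  · exfalso
    obtain ⟨_, _, _, h1, _⟩ := conn_of_conn_splitS_inr hind' hxT
    obtain ⟨_, _, _, h2, _⟩ := conn_of_conn_splitS_inr hind' hxTp
    rw [blue_eq_true_iff] at h2
    rw [h1] at h2
    exact absurd h2 (by simp)

end Core

section Orbit

variable {F : V → Prop} (hF : ∀ x, F x → (∀ S ∈ 𝓤, x ∈ S) ∨ (∀ S ∈ 𝓓'', x ∉ S) ∨ x ∈ X) (hhJ : h ∉ J) (hind : IndepSet ends J)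
  (hadj : ∀ u ∈ J, ∀ e (he : u ∈ ends e), Sym2.Mem.other he ≠ h →
    ∃ e', ends e' = s(Sym2.Mem.other he, h))
  (hout : ∀ x ∈ U, x ≠ h → x ∉ J →
    F x ∨ (∃ e y, ends e = s(x, y) ∧ y ∉ U) ∨ (∀ e, x ∉ ends e))

include hF hhJ hind hadj hout in
/-- A junction outside the matched set of `ζ₁` is unmatched in every configuration obtained
from `ζ₁` by arm flips of the graph split at that matched set (and fine for it). -/
lemma not_matched_of_flips_g {ζ₁ : Config E} (hζ₁ : ζ₁ ∈ gOutSide ends l h 𝓤 𝓓 𝓓'' X 𝓤' U ξ) {u : V}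
    (huJ : u ∈ J) (huM : u ∉ matchedSet ends J h ζ₁) {η : Config E}
    (hf : MFine ends (matchedSet ends J h ζ₁) h η)
    (hm : Matched (splitEndsS ends (matchedSet ends J h ζ₁)) (Sum.inl u) (Sum.inl h) η →
      Matched (splitEndsS ends (matchedSet ends J h ζ₁)) (Sum.inl u) (Sum.inl h) ζ₁) :
    ¬ Matched ends u h η := by
  intro hmη
  have hind' : IndepSet ends (matchedSet ends J h ζ₁) :=
    indepSet_mono (matchedSet_subset (ends := ends) (h := h) ζ₁) hind
  have hhM : h ∉ matchedSet ends J h ζ₁ := fun h' => hhJ h'.1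
  have hunb : ∀ e p, ends e = s(u, p) → p ∉ matchedSet ends J h ζ₁ ∧ p ≠ u := by
    intro e p hep
    constructor
    · intro hpM
      exact hind e u huJ p hpM.1 hep
    · rintro rfl
      exact hind e p huJ p huJ hep
  have hf₁ : MFine ends (matchedSet ends J h ζ₁) h ζ₁ :=
    mfine_matchedSet_g hF hhJ hind hadj hout hζ₁
  have h1 := (matched_iff_matched_splitS hind' hhM huM hunb hf).1 hmη
  have h2 := (matched_iff_matched_splitS hind' hhM huM hunb hf₁).2 (hm h1)
  exact huM ⟨huJ, h2⟩

include hF hhJ hind hadj hout in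
/-- **The matched set is constant along the orbit** of the graph split at it. -/
theorem matchedSet_orbitReal_g {ζ₁ : Config E} (hζ₁ : ζ₁ ∈ gOutSide ends l h 𝓤 𝓓 𝓓'' X 𝓤' U ξ)
    (ω : Config (arms (splitEndsS ends (matchedSet ends J h ζ₁))
      (allRed (splitEndsS ends (matchedSet ends J h ζ₁)) ζ₁ (Sum.inl h)) (Sum.inl h))) :
    matchedSet ends J h (orbitReal (splitEndsS ends (matchedSet ends J h ζ₁))
      (allRed (splitEndsS ends (matchedSet ends J h ζ₁)) ζ₁ (Sum.inl h)) (Sum.inl h) ω) =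
      matchedSet ends J h ζ₁ := by
  have hind' : IndepSet ends (matchedSet ends J h ζ₁) :=
    indepSet_mono (matchedSet_subset (ends := ends) (h := h) ζ₁) hind
  have hc₁ : CoreFree (splitEndsS ends (matchedSet ends J h ζ₁)) ζ₁ (Sum.inl h) :=
    coreFree_split_matchedSet_g hF hhJ hind hout hζ₁
  have hf₁ : MFine ends (matchedSet ends J h ζ₁) h ζ₁ :=
    mfine_matchedSet_g hF hhJ hind hadj hout hζ₁
  have hc₀ : CoreFree (splitEndsS ends (matchedSet ends J h ζ₁))
      (allRed (splitEndsS ends (matchedSet ends J h ζ₁)) ζ₁ (Sum.inl h)) (Sum.inl h) :=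
    coreFree_allRed hc₁
  have hfη : MFine ends (matchedSet ends J h ζ₁) h
      (orbitReal (splitEndsS ends (matchedSet ends J h ζ₁))
        (allRed (splitEndsS ends (matchedSet ends J h ζ₁)) ζ₁ (Sum.inl h)) (Sum.inl h) ω) := by
    intro e he
    rw [hull_orbitReal hc₀, hull_allRed hc₁]
    exact hf₁ e he
  ext u
  constructor
  · rintro ⟨huJ, hmu⟩
    by_contra huM
    refine not_matched_of_flips_g hF hhJ hind hadj hout hζ₁ huJ huM hfη (fun hm => ?_) hmu
    have h1 := matched_of_matched_flip (coreFree_allRed hc₀) (armClosed_armsFalse_allRed hc₀ ω) hm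
    rw [allRed_idem hc₁] at h1
    exact matched_of_matched_flip hc₁ (armClosed_blueSide hc₁) h1
  · intro huM
    exact ⟨huM.1, matched_of_mfine hind' hfη huM⟩

end Orbit

section Main

variable {F : V → Prop} (h𝓤 : IsUpperSet 𝓤) (h𝓓 : IsLowerSet 𝓓) (h𝓓'' : IsLowerSet 𝓓'')
  (h𝓤' : IsUpperSet 𝓤') (hD'' : ∀ T ∈ 𝓓'', T ∪ J ∈ 𝓓'') (hU' : ∀ T ∈ 𝓤', T \ J ∈ 𝓤')
  (hJX : ∀ u ∈ J, u ∉ X)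
  (hF : ∀ x, F x → (∀ S ∈ 𝓤, x ∈ S) ∨ (∀ S ∈ 𝓓'', x ∉ S) ∨ x ∈ X)
  (hl : l ∉ U) (hloop_h : ∀ e, ends e ≠ s(h, h)) (hJU : J ⊆ U) (hhJ : h ∉ J)
  (hind : IndepSet ends J)
  (hadj : ∀ u ∈ J, ∀ e (he : u ∈ ends e), Sym2.Mem.other he ≠ h →
    ∃ e', ends e' = s(Sym2.Mem.other he, h))
  (hout : ∀ x ∈ U, x ≠ h → x ∉ J →
    F x ∨ (∃ e y, ends e = s(x, y) ∧ y ∉ U) ∨ (∀ e, x ∉ ends e))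

include h𝓤 h𝓓 h𝓓'' h𝓤' hD'' hU' hJX hF hl hloop_h hJU hhJ hind hadj hout in
/-- **THE MULTI-JUNCTION THEOREM ON THE GENERAL DOUBLY TYPED SIDE**: the rigid counting inequality
on `gTypedQ` of every class of a region with an independent set `J` of junctions (no loop at `h`,
`h ∉ J`, every neighbour `p ≠ h` of a junction adjacent to `h`, the conditions on `h`'s clusters
blind to `J`, every vertex of `U ∖ {h}` outside `J` exempt, with an outside edge, or with no
edge). -/
theorem rigidOK_g_of_junctions {𝓔 : Set (Set E)} (h𝓔 : IsUpperSet 𝓔) :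
    ((gOutSide ends l h 𝓤 𝓓 𝓓'' X 𝓤' U ξ).filter fun ζ => redEdges ends ζ h ∈ 𝓔).card ≤
      ((gOutSide ends l h 𝓤 𝓓 𝓓'' X 𝓤' U ξ).filter fun ζ => blueEdges ends ζ h ∈ 𝓔).card := by
  have hlJ : l ∉ J := fun h' => hl (hJU h')
  let key : Config E → Set V × Config E := fun ζ =>
    (matchedSet ends J h ζ, allRed (splitEndsS ends (matchedSet ends J h ζ)) ζ (Sum.inl h))
  let S₀ : Finset (Set V × Config E) := (gOutSide ends l h 𝓤 𝓓 𝓓'' X 𝓤' U ξ).image key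
  have hmap : ∀ (P : Config E → Prop) (ζ : Config E),
      ζ ∈ (gOutSide ends l h 𝓤 𝓓 𝓓'' X 𝓤' U ξ).filter P → key ζ ∈ S₀ :=
    fun P ζ hζ => Finset.mem_image_of_mem key (Finset.mem_filter.1 hζ).1
  rw [Finset.card_eq_sum_card_fiberwise (hmap _), Finset.card_eq_sum_card_fiberwise (hmap _)]
  refine Finset.sum_le_sum fun k hk => ?_
  obtain ⟨ζ₁, hζ₁, rfl⟩ := Finset.mem_image.1 hk
  have hind' : IndepSet ends (matchedSet ends J h ζ₁) :=
    indepSet_mono (matchedSet_subset (ends := ends) (h := h) ζ₁) hind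
  have hMU : matchedSet ends J h ζ₁ ⊆ U := fun u hu => hJU hu.1
  have hhM : h ∉ matchedSet ends J h ζ₁ := fun h' => hhJ h'.1
  have hlM : l ∉ matchedSet ends J h ζ₁ := fun h' => hlJ h'.1
  have hD''M : ∀ T ∈ 𝓓'', T ∪ matchedSet ends J h ζ₁ ∈ 𝓓'' := fun T hT =>
    h𝓓'' (Set.union_subset_union_right T (matchedSet_subset ζ₁)) (hD'' T hT)
  have hU'M : ∀ T ∈ 𝓤', T \ matchedSet ends J h ζ₁ ∈ 𝓤' := fun T hT =>
    h𝓤' (Set.sdiff_subset_sdiff_right (matchedSet_subset ζ₁)) (hU' T hT)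
  have hl' := inl_notMem_splitRegionS (V := V) (E := E) (U := U) hl
  have hloop' := splitEndsS_ne_loop_h (ends := ends) (S := matchedSet ends J h ζ₁) hloop_h
  have hc₁ : CoreFree (splitEndsS ends (matchedSet ends J h ζ₁)) ζ₁ (Sum.inl h) :=
    coreFree_split_matchedSet_g hF hhJ hind hout hζ₁
  have hf₁ : MFine ends (matchedSet ends J h ζ₁) h ζ₁ :=
    mfine_matchedSet_g hF hhJ hind hadj hout hζ₁
  have hcl₁ : ζ₁ ∈ outClass (splitEndsS ends (matchedSet ends J h ζ₁)) (splitRegionS U)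
      (Sum.inl h) ξ :=
    mem_outClass_splitS_of_mem hind' hMU (mem_gOutSide.1 hζ₁).2
  have hc₀ : CoreFree (splitEndsS ends (matchedSet ends J h ζ₁))
      (allRed (splitEndsS ends (matchedSet ends J h ζ₁)) ζ₁ (Sum.inl h)) (Sum.inl h) :=
    coreFree_allRed hc₁
  have hcl₀ : allRed (splitEndsS ends (matchedSet ends J h ζ₁)) ζ₁ (Sum.inl h) ∈
      outClass (splitEndsS ends (matchedSet ends J h ζ₁)) (splitRegionS U) (Sum.inl h) ξ :=
    allRed_mem_outClass hcl₁ hc₁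
  have hfib : ∀ (P P' : Config E → Prop),
      (∀ ζ, MFine ends (matchedSet ends J h ζ₁) h ζ → (P ζ ↔ P' ζ)) →
      ((gOutSide ends l h 𝓤 𝓓 𝓓'' X 𝓤' U ξ).filter P).filter (fun ζ => key ζ = key ζ₁) =
        (orbit (splitEndsS ends (matchedSet ends J h ζ₁))
          (allRed (splitEndsS ends (matchedSet ends J h ζ₁)) ζ₁ (Sum.inl h)) (Sum.inl h)).filter
          fun ζ' => ζ' ∈ gTypedQ (splitEndsS ends (matchedSet ends J h ζ₁)) (Sum.inl l) (Sum.inl h)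
            (pullInl E 𝓤) (pullInl E 𝓓) (pullInl E 𝓓'') (Sum.inl '' X) (pullInl E 𝓤') ∧ P' ζ' := by
    intro P P' hPP'
    ext ζ'
    simp only [Finset.mem_filter, orbit, Finset.mem_image, Finset.mem_univ, true_and, key,
      Prod.mk.injEq]
    constructor
    · rintro ⟨⟨hζ', hP⟩, hMeq, hred⟩
      rw [hMeq] at hred
      have hf' : MFine ends (matchedSet ends J h ζ₁) h ζ' := by
        rw [← hMeq]; exact mfine_matchedSet_g hF hhJ hind hadj hout hζ'
      have hc' : CoreFree (splitEndsS ends (matchedSet ends J h ζ₁)) ζ' (Sum.inl h) := by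
        rw [← hMeq]; exact coreFree_split_matchedSet_g hF hhJ hind hout hζ'
      obtain ⟨ω, hω⟩ := exists_orbitReal_eq hc' hred
      exact ⟨⟨ω, hω⟩, mem_gTypedQ_splitS_of_mem hind' hlM hhM h𝓓'' (fun T hT => hU'M T hT) hf' (mem_gOutSide.1 hζ').1,
        (hPP' ζ' hf').1 hP⟩
    · rintro ⟨⟨ω, rfl⟩, hQ', hP'⟩
      have hf' : MFine ends (matchedSet ends J h ζ₁) h
          (orbitReal (splitEndsS ends (matchedSet ends J h ζ₁))
            (allRed (splitEndsS ends (matchedSet ends J h ζ₁)) ζ₁ (Sum.inl h)) (Sum.inl h) ω) := by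
        intro e he
        rw [hull_orbitReal hc₀, hull_allRed hc₁]
        exact hf₁ e he
      have hcl' := orbitReal_mem_outClass hc₀ hcl₀ ω
      have hMeq := matchedSet_orbitReal_g hF hhJ hind hadj hout hζ₁ ω
      refine ⟨⟨mem_gOutSide.2 ⟨mem_gTypedQ_of_mem_splitS hind' hlM hhM h𝓓'' h𝓤' (fun T hT => hD''M T hT) (fun u hu => hJX u hu.1) hf' hQ',
        mem_outClass_of_mem_splitS hind' hMU hhM hf' hcl'⟩, (hPP' _ hf').2 hP'⟩, hMeq, ?_⟩
      rw [hMeq, allRed_orbitReal hc₀ ω, allRed_idem hc₁]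
  rw [hfib _ (fun ζ' => redEdges (splitEndsS ends (matchedSet ends J h ζ₁)) ζ' (Sum.inl h) ∈ 𝓔)
      (fun ζ hf => by rw [redEdges_eq_of_mfine hind' hhM hf]),
    hfib _ (fun ζ' => blueEdges (splitEndsS ends (matchedSet ends J h ζ₁)) ζ' (Sum.inl h) ∈ 𝓔)
      (fun ζ hf => by rw [blueEdges_eq_of_mfine hind' hhM hf])]
  exact card_orbit_le_g hc₀ hloop' (isUpperSet_pullInl h𝓤) (isLowerSet_pullInl h𝓓)
    (isLowerSet_pullInl h𝓓'') (isUpperSet_pullInl h𝓤') hcl₀ hl' h𝓔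

end Main

section Graph

variable {F : V → Prop}

/-- **The general doubly typed row on every graph with an independent set `J` of junctions** in
the region `{l}ᶜ` (`l, h ∉ J`, no loop at `h`, every neighbour `p ≠ h` of a junction adjacent to
`h`, the conditions on `h`'s clusters blind to `J`, every other vertex exempt, joined to `l`, or
isolated) — g11's class B2 for g7's row. -/
theorem gTypedSwAll_of_junctions (hlh : l ≠ h) (hloop_h : ∀ e, ends e ≠ s(h, h)) (hlJ : l ∉ J)
    (hhJ : h ∉ J) (hind : IndepSet ends J)
    (h𝓤 : IsUpperSet 𝓤) (h𝓓 : IsLowerSet 𝓓) (h𝓓'' : IsLowerSet 𝓓'') (h𝓤' : IsUpperSet 𝓤')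
    (hD'' : ∀ T ∈ 𝓓'', T ∪ J ∈ 𝓓'') (hU' : ∀ T ∈ 𝓤', T \ J ∈ 𝓤') (hJX : ∀ u ∈ J, u ∉ X)
    (hF : ∀ x, F x → (∀ S ∈ 𝓤, x ∈ S) ∨ (∀ S ∈ 𝓓'', x ∉ S) ∨ x ∈ X)
    (hadj : ∀ u ∈ J, ∀ e (he : u ∈ ends e), Sym2.Mem.other he ≠ h →
      ∃ e', ends e' = s(Sym2.Mem.other he, h))
    (hout : ∀ x, x ≠ l → x ≠ h → x ∉ J →
      F x ∨ (∃ e, ends e = s(x, l)) ∨ (∀ e, x ∉ ends e)) :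
    GTypedSwAll ends l h 𝓤 𝓓 𝓓'' X 𝓤' := by
  refine exists_swAll_injection_of_card_le h _ (card_le_g_of_classes hlh fun ξ 𝓔 h𝓔 => ?_)
  refine rigidOK_g_of_junctions (ξ := ξ) (J := J) h𝓤 h𝓓 h𝓓'' h𝓤' hD'' hU' hJX hF (by simp)
    hloop_h
    (fun u hu => by
      simp only [Set.mem_compl_iff, Set.mem_singleton_iff]
      rintro rfl
      exact hlJ hu) hhJ hind hadj ?_ h𝓔
  intro x hx hxh hxJ
  rcases hout x (by simpa using hx) hxh hxJ with hf | ⟨e, he⟩ | hiso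
  · exact Or.inl hf
  · exact Or.inr (Or.inl ⟨e, l, he, by simp⟩)
  · exact Or.inr (Or.inr hiso)

end Graph

end LocRows

end Summit.Ventures.PercRepro2
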